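import Summits.AnomalousDissipation.AnomalousDissipation.Theorems.SawtoothPulseCascadeK1LocalisedCascadeKHModeCreation

/-!
# K2 lane (route-2 `SawtoothPulseCascade`, crux dir `K1LocalisedCascade`): the single-mode creation law with the PAIRED envelope — a `1/ξ²` far-mode weight

Helper file of the K2 lane (ACL item stmt-AnomalousDissipation-19491; memo `K2BookReduction-p2.md` §0/§2: the input of the V→V truncation tails and of the
energy-form creation law). `…KHModePairedSource`/`…Neg` bound the single-mode source at a lattice mode `ξ = β + n` by the PAIRED envelope
`env(s) = N·(1 + |s|/2)·(1/(1+(u+s)²) + 1/(1+(u−s)²))/((1−q)κ²)`, `u = ξ/a`, `N = 1 + q + 2x²`. This file integrates it through the stable block's Duhamel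
formula (`norm_duhamel_env_le` of `…KHModeCreation`): the `arctan` window `∫₀^θ (1/(1+(u+s)²) + 1/(1+(u−s)²)) ds = arctan(u+θ) − arctan(u−θ) ≤ π`,
and `≤ 2θ/(1+(|u|−θ)²)` for `|u| ≥ θ`; hence the created amplitude of a single lattice mode is at most
`4πa(ap+2a‖S‖)/ω · N(1+θ/2)(arctan(u+θ) − arctan(u−θ))/((1−q)κ²)` (`mode_component_paired_le`), numerically `≤ 5.0002/a` for every mode and
`≤ 25.5/(a(1+(|u|−8)²))` for `|u| ≥ 16` (`a ≥ 4`, `0 ≤ θ ≤ 8`): quadratic decay in the mode, where the envelope law (`mode_factor_le_of_far`) has `5.14/|ξ|`.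
No definitions; no statement about the crux. [folklore] [problem: turb]
-/

-- `Summit.<Summit>.<Problem>`: single-conjunct summit, the duplicate namespace segment is deliberate.
set_option linter.dupNamespace false

noncomputable section

namespace Summit.AnomalousDissipation.AnomalousDissipation.Theorems.SawtoothPulseCascade.K2PhaseBudget

open Set MeasureTheory intervalIntegral Literature.Analysis.FluidPDE.SawtoothCascade

/-! ## §1 The `arctan` window -/

/-- The shifted Lorentzian is continuous. [folklore] -/
theorem continuous_inv_one_add_sq_shift (c : ℝ) : Continuous fun s : ℝ => (1 + (s + c) ^ 2)⁻¹ :=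
  Continuous.inv₀ (by fun_prop) fun s => (by positivity : (0 : ℝ) < 1 + (s + c) ^ 2).ne'

/-- `∫₀^θ ds/(1+(s+c)²) = arctan(θ+c) − arctan(c)`. [folklore] -/
theorem integral_inv_one_add_sq_shift (c θ : ℝ) :
    ∫ s in (0 : ℝ)..θ, (1 + (s + c) ^ 2)⁻¹ = Real.arctan (θ + c) - Real.arctan c := by
  have h := intervalIntegral.integral_comp_add_right (a := 0) (b := θ) (fun x : ℝ => (1 + x ^ 2)⁻¹) c
  rw [h, zero_add]
  have h2 := integral_inv_one_add_sq (a := c) (b := θ + c)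
  rw [h2]

/-- The `arctan` window is at most `π`. [folklore] -/
theorem arctan_window_le_pi (u θ : ℝ) : Real.arctan (u + θ) - Real.arctan (u - θ) ≤ Real.pi := by
  have h1 := Real.arctan_lt_pi_div_two (u + θ)
  have h2 := Real.neg_pi_div_two_lt_arctan (u - θ)
  linarith

/-- The `arctan` window is nonnegative for `θ ≥ 0`. [folklore] -/
theorem arctan_window_nonneg {θ : ℝ} (hθ : 0 ≤ θ) (u : ℝ) : 0 ≤ Real.arctan (u + θ) - Real.arctan (u - θ) := by
  have := Real.arctan_strictMono.monotone (show u - θ ≤ u + θ by linarith)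
  linarith

/-- **Far window:** for `0 ≤ θ ≤ u`, `arctan(u+θ) − arctan(u−θ) ≤ 2θ/(1+(u−θ)²)` (mean value: `arctan′ ≤ 1/(1+(u−θ)²)` on `[u−θ, u+θ]`). [folklore] -/
theorem arctan_window_le_far {θ u : ℝ} (hθ : 0 ≤ θ) (hu : θ ≤ u) :
    Real.arctan (u + θ) - Real.arctan (u - θ) ≤ 2 * θ / (1 + (u - θ) ^ 2) := by
  have hx0 : 0 ≤ u - θ := by linarith
  have hbound : ∀ x ∈ interior (Set.Ici (u - θ)), deriv Real.arctan x ≤ (1 + (u - θ) ^ 2)⁻¹ := by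
    intro x hx
    rw [interior_Ici] at hx
    rw [(Real.hasDerivAt_arctan x).deriv, one_div]
    have hx' : u - θ < x := hx
    exact inv_anti₀ (by positivity) (by nlinarith)
  have h := (convex_Ici (u - θ)).image_sub_le_mul_sub_of_deriv_le Real.continuous_arctan.continuousOn
    Real.differentiable_arctan.differentiableOn hbound (u - θ) (Set.mem_Ici.2 le_rfl) (u + θ) (Set.mem_Ici.2 (by linarith)) (by linarith)
  rw [show u + θ - (u - θ) = 2 * θ by ring] at h
  rw [div_eq_mul_inv, mul_comm]
  linarith

/-- Far window, both signs: for `0 ≤ θ ≤ |u|`, `arctan(u+θ) − arctan(u−θ) ≤ 2θ/(1+(|u|−θ)²)` (`arctan` is odd). [folklore] -/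
theorem arctan_window_le_far_abs {θ u : ℝ} (hθ : 0 ≤ θ) (hu : θ ≤ |u|) :
    Real.arctan (u + θ) - Real.arctan (u - θ) ≤ 2 * θ / (1 + (|u| - θ) ^ 2) := by
  rcases le_or_gt 0 u with h | h
  · rw [abs_of_nonneg h] at hu ⊢; exact arctan_window_le_far hθ hu
  · rw [abs_of_neg h] at hu ⊢
    have h2 := arctan_window_le_far hθ hu
    rw [show -u + θ = -(u - θ) by ring, show -u - θ = -(u + θ) by ring, Real.arctan_neg, Real.arctan_neg,
      show (-(u + θ)) ^ 2 = (-u - θ) ^ 2 by ring] at h2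
    linarith

/-! ## §2 The integral of the paired envelope -/

/-- `∫₀^θ (1/(1+(u+s)²) + 1/(1+(u−s)²)) ds = arctan(u+θ) − arctan(u−θ)`. [folklore] -/
theorem integral_pairedLorentz (u θ : ℝ) :
    ∫ s in (0 : ℝ)..θ, (1 / (1 + (u + 1 * s) ^ 2) + 1 / (1 + (u + (-1) * s) ^ 2)) = Real.arctan (u + θ) - Real.arctan (u - θ) := by
  have e1 : ∀ s : ℝ, 1 / (1 + (u + 1 * s) ^ 2) = (1 + (s + u) ^ 2)⁻¹ := fun s => by rw [one_div]; ring_nf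
  have e2 : ∀ s : ℝ, 1 / (1 + (u + (-1) * s) ^ 2) = (1 + (s + (-u)) ^ 2)⁻¹ := fun s => by rw [one_div]; ring_nf
  simp_rw [e1, e2]
  rw [intervalIntegral.integral_add ((continuous_inv_one_add_sq_shift u).intervalIntegrable _ _)
    ((continuous_inv_one_add_sq_shift (-u)).intervalIntegrable _ _), integral_inv_one_add_sq_shift, integral_inv_one_add_sq_shift,
    show θ + -u = -(u - θ) by ring, Real.arctan_neg, Real.arctan_neg, show θ + u = u + θ by ring]
  ring

/-- The paired envelope is continuous in the strain time. [folklore] -/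
theorem continuous_pairedEnv (N u D : ℝ) :
    Continuous fun s : ℝ => N * (1 + |s| / 2) * (1 / (1 + (u + 1 * s) ^ 2) + 1 / (1 + (u + (-1) * s) ^ 2)) / D := by
  have h1 : ∀ s : ℝ, (1 + (u + 1 * s) ^ 2) ≠ 0 := fun s => by positivity
  have h2 : ∀ s : ℝ, (1 + (u + (-1) * s) ^ 2) ≠ 0 := fun s => by positivity
  refine Continuous.div_const (Continuous.mul (by fun_prop) (Continuous.add ?_ ?_)) D
  · exact Continuous.div continuous_const (by fun_prop) h1
  · exact Continuous.div continuous_const (by fun_prop) h2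

/-- **Integral of the paired envelope over the slot:** `∫₀^θ N(1+|s|/2)(…)/D ≤ N(1+θ/2)(arctan(u+θ) − arctan(u−θ))/D` (`N, D, θ ≥ 0`). [folklore] -/
theorem integral_pairedEnv_le {N D θ : ℝ} (hN : 0 ≤ N) (hD : 0 < D) (hθ : 0 ≤ θ) (u : ℝ) :
    ∫ s in (0 : ℝ)..θ, N * (1 + |s| / 2) * (1 / (1 + (u + 1 * s) ^ 2) + 1 / (1 + (u + (-1) * s) ^ 2)) / D ≤
      N * (1 + θ / 2) * (Real.arctan (u + θ) - Real.arctan (u - θ)) / D := by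
  have hmono : ∫ s in (0 : ℝ)..θ, N * (1 + |s| / 2) * (1 / (1 + (u + 1 * s) ^ 2) + 1 / (1 + (u + (-1) * s) ^ 2)) / D ≤
      ∫ s in (0 : ℝ)..θ, N * (1 + θ / 2) / D * (1 / (1 + (u + 1 * s) ^ 2) + 1 / (1 + (u + (-1) * s) ^ 2)) := by
    refine intervalIntegral.integral_mono_on hθ ((continuous_pairedEnv N u D).intervalIntegrable _ _)
      (Continuous.intervalIntegrable (by
        have h1 : ∀ s : ℝ, (1 + (u + 1 * s) ^ 2) ≠ 0 := fun s => by positivity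
        have h2 : ∀ s : ℝ, (1 + (u + (-1) * s) ^ 2) ≠ 0 := fun s => by positivity
        exact continuous_const.mul ((Continuous.div continuous_const (by fun_prop) h1).add (Continuous.div continuous_const (by fun_prop) h2))) _ _)
      fun s hs => ?_
    have hs0 : 0 ≤ s := hs.1
    have hL : 0 ≤ 1 / (1 + (u + 1 * s) ^ 2) + 1 / (1 + (u + (-1) * s) ^ 2) := by positivity
    rw [abs_of_nonneg hs0, div_mul_eq_mul_div]
    refine div_le_div_of_nonneg_right ?_ hD.le
    refine mul_le_mul_of_nonneg_right (mul_le_mul_of_nonneg_left (by linarith [hs.2]) hN) hL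
  refine hmono.trans (le_of_eq ?_)
  rw [intervalIntegral.integral_const_mul, integral_pairedLorentz]
  ring

/-! ## §3 Single-mode creation with the paired envelope (symbolic, mode-resolved) -/

section mode

variable {a β θ ξ : ℝ} {G0 Gh : ℂ} {S₀ S₁ : ℝ → ℂ}

/-- **Single-mode creation at a lattice mode, component `0`, PAIRED envelope:** amplitude
`≤ 4πa(a·p + 2a‖S‖)/ω · N(1+θ/2)(arctan(ξ/a+θ) − arctan(ξ/a−θ))/((1−q)κ²)` (`a ≥ 1`, `θ ≥ 0`). [cite: Drazin2002, §8.3 (8.36)–(8.38)] -/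
theorem mode_component_paired_le (ha : 1 ≤ a) (hθ : 0 ≤ θ) (h0 : (2 * Real.pi : ℂ) * G0 = ((sawSigma0 a β : ℝ) : ℂ))
    (hh : (2 * Real.pi : ℂ) * starRingEnd ℂ Gh = sawS a β)
    (hE₀ : ∀ s, ‖S₀ s‖ ≤ (1 + Real.exp (-(2 * Real.pi * a)) + 2 * Real.exp (-(2 * Real.pi * a) / 4) ^ 2) * (1 + |s| / 2) *
          (1 / (1 + (ξ / a + 1 * s) ^ 2) + 1 / (1 + (ξ / a + (-1) * s) ^ 2)) / ((1 - Real.exp (-(2 * Real.pi * a))) * (2 * Real.pi * a) ^ 2))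
    (hE₁ : ∀ s, ‖S₁ s‖ ≤ (1 + Real.exp (-(2 * Real.pi * a)) + 2 * Real.exp (-(2 * Real.pi * a) / 4) ^ 2) * (1 + |s| / 2) *
          (1 / (1 + (ξ / a + 1 * s) ^ 2) + 1 / (1 + (ξ / a + (-1) * s) ^ 2)) / ((1 - Real.exp (-(2 * Real.pi * a))) * (2 * Real.pi * a) ^ 2)) :
    ‖∫ s in (0 : ℝ)..θ, ((Real.cos (a * Real.sqrt (max 0 (sawC2 a β)) * (θ - s)) : ℂ) *
          ((((2 * Real.pi * a : ℝ) * Complex.I : ℂ) * (-2)) * S₀ s) +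
        ((Real.sin (a * Real.sqrt (max 0 (sawC2 a β)) * (θ - s)) / (a * Real.sqrt (max 0 (sawC2 a β))) : ℝ) : ℂ) *
          ((((2 * Real.pi * a : ℝ) : ℂ) * Complex.I) * (-(1 / 4 : ℂ) - 2 * G0) * ((((2 * Real.pi * a : ℝ) * Complex.I : ℂ) * (-2)) * S₀ s) +
            (((2 * Real.pi * a : ℝ) : ℂ) * Complex.I) * (-2 * Gh) * ((((2 * Real.pi * a : ℝ) * Complex.I : ℂ) * 2) * S₁ s)))‖ ≤
      4 * Real.pi * a * (a * (Real.pi / 2 + 2 * sawSigma0 a β) + 2 * a * ‖sawS a β‖) / (a * Real.sqrt (max 0 (sawC2 a β))) *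
        ((1 + Real.exp (-(2 * Real.pi * a)) + 2 * Real.exp (-(2 * Real.pi * a) / 4) ^ 2) * (1 + θ / 2) *
          (Real.arctan (ξ / a + θ) - Real.arctan (ξ / a - θ)) / ((1 - Real.exp (-(2 * Real.pi * a))) * (2 * Real.pi * a) ^ 2)) := by
  have ha0 : 0 < a := by linarith
  have hω0 : 0 < a * Real.sqrt (max 0 (sawC2 a β)) := by have := omega_ge ha β; linarith
  have hp := kh_p_nonneg ha β
  have hdiag := norm_blockX_diag_eq ha0 h0
  rw [abs_of_nonneg hp] at hdiag
  have hωx : a * Real.sqrt (max 0 (sawC2 a β)) ≤ ‖(((2 * Real.pi * a : ℝ) : ℂ) * Complex.I) * (-(1 / 4 : ℂ) - 2 * G0)‖ := by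
    rw [hdiag, ← abs_of_nonneg hp]; exact omega_le_diag ha β
  have hq1 : Real.exp (-(2 * Real.pi * a)) < 1 := Real.exp_lt_one_iff.2 (by nlinarith [Real.pi_pos])
  have hD : 0 < (1 - Real.exp (-(2 * Real.pi * a))) * (2 * Real.pi * a) ^ 2 := by
    have : 0 < (2 * Real.pi * a) ^ 2 := by positivity
    nlinarith
  have hN : 0 ≤ 1 + Real.exp (-(2 * Real.pi * a)) + 2 * Real.exp (-(2 * Real.pi * a) / 4) ^ 2 := by positivity
  have henv := continuous_pairedEnv (1 + Real.exp (-(2 * Real.pi * a)) + 2 * Real.exp (-(2 * Real.pi * a) / 4) ^ 2) (ξ / a)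
    ((1 - Real.exp (-(2 * Real.pi * a))) * (2 * Real.pi * a) ^ 2)
  have h := norm_duhamel_env_le (c₀ := ((2 * Real.pi * a : ℝ) * Complex.I : ℂ) * (-2)) (c₁ := ((2 * Real.pi * a : ℝ) * Complex.I : ℂ) * 2)
    (x₁ := (((2 * Real.pi * a : ℝ) : ℂ) * Complex.I) * (-2 * Gh)) hθ hω0 (blockX_diag_re h0) hωx henv hE₀ hE₁
  have hI := integral_pairedEnv_le hN hD hθ (ξ / a)
  have hκ : 0 < 2 * Real.pi * a := by positivity
  have hc0 : ‖(((2 * Real.pi * a : ℝ) * Complex.I : ℂ) * (-2))‖ = 4 * Real.pi * a := by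
    rw [norm_mul, norm_mul, Complex.norm_real, Complex.norm_I, Real.norm_eq_abs, abs_of_pos hκ, norm_neg]; simp; ring
  have hc1 : ‖(((2 * Real.pi * a : ℝ) * Complex.I : ℂ) * 2)‖ = 4 * Real.pi * a := by
    rw [norm_mul, norm_mul, Complex.norm_real, Complex.norm_I, Real.norm_eq_abs, abs_of_pos hκ]; simp; ring
  rw [hc0, hc1, hdiag, norm_blockX_off_eq ha0 hh] at h
  have hpre : 0 ≤ (a * (Real.pi / 2 + 2 * sawSigma0 a β) * (4 * Real.pi * a) + 2 * a * ‖sawS a β‖ * (4 * Real.pi * a)) /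
      (a * Real.sqrt (max 0 (sawC2 a β))) := by positivity
  refine h.trans ((mul_le_mul_of_nonneg_left hI hpre).trans (le_of_eq ?_))
  ring

/-- **Component `1`, PAIRED envelope.** [cite: Drazin2002, §8.3 (8.36)–(8.38)] -/
theorem mode_component_paired_le' (ha : 1 ≤ a) (hθ : 0 ≤ θ) (h0 : (2 * Real.pi : ℂ) * G0 = ((sawSigma0 a β : ℝ) : ℂ))
    (hh : (2 * Real.pi : ℂ) * starRingEnd ℂ Gh = sawS a β)
    (hE₀ : ∀ s, ‖S₀ s‖ ≤ (1 + Real.exp (-(2 * Real.pi * a)) + 2 * Real.exp (-(2 * Real.pi * a) / 4) ^ 2) * (1 + |s| / 2) *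
          (1 / (1 + (ξ / a + 1 * s) ^ 2) + 1 / (1 + (ξ / a + (-1) * s) ^ 2)) / ((1 - Real.exp (-(2 * Real.pi * a))) * (2 * Real.pi * a) ^ 2))
    (hE₁ : ∀ s, ‖S₁ s‖ ≤ (1 + Real.exp (-(2 * Real.pi * a)) + 2 * Real.exp (-(2 * Real.pi * a) / 4) ^ 2) * (1 + |s| / 2) *
          (1 / (1 + (ξ / a + 1 * s) ^ 2) + 1 / (1 + (ξ / a + (-1) * s) ^ 2)) / ((1 - Real.exp (-(2 * Real.pi * a))) * (2 * Real.pi * a) ^ 2)) :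
    ‖∫ s in (0 : ℝ)..θ, ((Real.cos (a * Real.sqrt (max 0 (sawC2 a β)) * (θ - s)) : ℂ) *
          ((((2 * Real.pi * a : ℝ) * Complex.I : ℂ) * 2) * S₁ s) +
        ((Real.sin (a * Real.sqrt (max 0 (sawC2 a β)) * (θ - s)) / (a * Real.sqrt (max 0 (sawC2 a β))) : ℝ) : ℂ) *
          ((((2 * Real.pi * a : ℝ) : ℂ) * Complex.I) * (2 * starRingEnd ℂ Gh) * ((((2 * Real.pi * a : ℝ) * Complex.I : ℂ) * (-2)) * S₀ s) +
            (((2 * Real.pi * a : ℝ) : ℂ) * Complex.I) * ((1 / 4 : ℂ) + 2 * G0) * ((((2 * Real.pi * a : ℝ) * Complex.I : ℂ) * 2) * S₁ s)))‖ ≤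
      4 * Real.pi * a * (a * (Real.pi / 2 + 2 * sawSigma0 a β) + 2 * a * ‖sawS a β‖) / (a * Real.sqrt (max 0 (sawC2 a β))) *
        ((1 + Real.exp (-(2 * Real.pi * a)) + 2 * Real.exp (-(2 * Real.pi * a) / 4) ^ 2) * (1 + θ / 2) *
          (Real.arctan (ξ / a + θ) - Real.arctan (ξ / a - θ)) / ((1 - Real.exp (-(2 * Real.pi * a))) * (2 * Real.pi * a) ^ 2)) := by
  have ha0 : 0 < a := by linarith
  have hω0 : 0 < a * Real.sqrt (max 0 (sawC2 a β)) := by have := omega_ge ha β; linarith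
  have hp := kh_p_nonneg ha β
  have hdiag := norm_blockX_diag_eq' ha0 h0
  rw [abs_of_nonneg hp] at hdiag
  have hωx : a * Real.sqrt (max 0 (sawC2 a β)) ≤ ‖(((2 * Real.pi * a : ℝ) : ℂ) * Complex.I) * ((1 / 4 : ℂ) + 2 * G0)‖ := by
    rw [hdiag, ← abs_of_nonneg hp]; exact omega_le_diag ha β
  have hq1 : Real.exp (-(2 * Real.pi * a)) < 1 := Real.exp_lt_one_iff.2 (by nlinarith [Real.pi_pos])
  have hD : 0 < (1 - Real.exp (-(2 * Real.pi * a))) * (2 * Real.pi * a) ^ 2 := by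
    have : 0 < (2 * Real.pi * a) ^ 2 := by positivity
    nlinarith
  have hN : 0 ≤ 1 + Real.exp (-(2 * Real.pi * a)) + 2 * Real.exp (-(2 * Real.pi * a) / 4) ^ 2 := by positivity
  have henv := continuous_pairedEnv (1 + Real.exp (-(2 * Real.pi * a)) + 2 * Real.exp (-(2 * Real.pi * a) / 4) ^ 2) (ξ / a)
    ((1 - Real.exp (-(2 * Real.pi * a))) * (2 * Real.pi * a) ^ 2)
  have h := norm_duhamel_env_le' (c₀ := ((2 * Real.pi * a : ℝ) * Complex.I : ℂ) * (-2)) (c₁ := ((2 * Real.pi * a : ℝ) * Complex.I : ℂ) * 2)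
    (x₀ := (((2 * Real.pi * a : ℝ) : ℂ) * Complex.I) * (2 * starRingEnd ℂ Gh)) hθ hω0 (blockX_diag_re' h0) hωx henv hE₀ hE₁
  have hI := integral_pairedEnv_le hN hD hθ (ξ / a)
  have hκ : 0 < 2 * Real.pi * a := by positivity
  have hc0 : ‖(((2 * Real.pi * a : ℝ) * Complex.I : ℂ) * (-2))‖ = 4 * Real.pi * a := by
    rw [norm_mul, norm_mul, Complex.norm_real, Complex.norm_I, Real.norm_eq_abs, abs_of_pos hκ, norm_neg]; simp; ring
  have hc1 : ‖(((2 * Real.pi * a : ℝ) * Complex.I : ℂ) * 2)‖ = 4 * Real.pi * a := by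
    rw [norm_mul, norm_mul, Complex.norm_real, Complex.norm_I, Real.norm_eq_abs, abs_of_pos hκ]; simp; ring
  rw [hc0, hc1, hdiag, norm_blockX_off_eq' ha0 hh] at h
  have hpre : 0 ≤ (a * (Real.pi / 2 + 2 * sawSigma0 a β) * (4 * Real.pi * a) + 2 * a * ‖sawS a β‖ * (4 * Real.pi * a)) /
      (a * Real.sqrt (max 0 (sawC2 a β))) := by positivity
  refine h.trans ((mul_le_mul_of_nonneg_left hI hpre).trans (le_of_eq ?_))
  ring

end mode

/-! ## §4 The numbers at `a ≥ 4`, `0 ≤ θ ≤ 8` -/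

/-- **The paired mode factor, every mode:** `≤ 5.0002/a` (`arctan` window `≤ π`). [folklore] -/
theorem paired_mode_factor_le {a : ℝ} (ha : 4 ≤ a) (β ξ : ℝ) {θ : ℝ} (hθ0 : 0 ≤ θ) (hθ : θ ≤ 8) :
    4 * Real.pi * a * (a * (Real.pi / 2 + 2 * sawSigma0 a β) + 2 * a * ‖sawS a β‖) / (a * Real.sqrt (max 0 (sawC2 a β))) *
        ((1 + Real.exp (-(2 * Real.pi * a)) + 2 * Real.exp (-(2 * Real.pi * a) / 4) ^ 2) * (1 + θ / 2) *
          (Real.arctan (ξ / a + θ) - Real.arctan (ξ / a - θ)) / ((1 - Real.exp (-(2 * Real.pi * a))) * (2 * Real.pi * a) ^ 2)) ≤ 5.0002 / a := by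
  have ha1 : 1 ≤ a := by linarith
  have ha0 : 0 < a := by linarith
  have hπ : (3.1415 : ℝ) < Real.pi := Real.pi_gt_d4
  have hπ' : Real.pi < 3.1416 := Real.pi_lt_d4
  have hR : (a * (Real.pi / 2 + 2 * sawSigma0 a β) + 2 * a * ‖sawS a β‖) / (a * Real.sqrt (max 0 (sawC2 a β))) ≤ 1.00002 :=
    (comb_ratio_le ha1 β).trans (by linarith [comb_ratio_defect_le ha β])
  have hR0 : 0 ≤ (a * (Real.pi / 2 + 2 * sawSigma0 a β) + 2 * a * ‖sawS a β‖) / (a * Real.sqrt (max 0 (sawC2 a β))) := by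
    have := kh_p_ge ha1 β; positivity
  have hx := exp_neg_quarter_kappa_le ha
  have hx0 : 0 ≤ Real.exp (-(2 * Real.pi * a) / 4) := (Real.exp_pos _).le
  have hq : Real.exp (-(2 * Real.pi * a)) ≤ (1 / 400) ^ 4 := exp_neg_kappa_le_pow ha
  have hq0 : 0 < Real.exp (-(2 * Real.pi * a)) := Real.exp_pos _
  have hW := arctan_window_le_pi (ξ / a) θ
  have hW0 := arctan_window_nonneg hθ0 (ξ / a)
  set x := Real.exp (-(2 * Real.pi * a) / 4) with hxdef
  set q := Real.exp (-(2 * Real.pi * a)) with hqdef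
  set R := (a * (Real.pi / 2 + 2 * sawSigma0 a β) + 2 * a * ‖sawS a β‖) / (a * Real.sqrt (max 0 (sawC2 a β))) with hR_def
  set W := Real.arctan (ξ / a + θ) - Real.arctan (ξ / a - θ) with hW_def
  have hN : 1 + q + 2 * x ^ 2 ≤ 1.0000126 := by
    have h2 : x ^ 2 ≤ (1 / 400) ^ 2 := pow_le_pow_left₀ hx0 hx 2
    norm_num at h2 hq ⊢; linarith
  have h1q : 0 < 1 - q := by norm_num at hq; linarith
  have h1q' : 1 / (1 - q) ≤ 1.0000001 := by
    rw [div_le_iff₀ h1q]; norm_num at hq ⊢; linarith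
  have e : 4 * Real.pi * a * (a * (Real.pi / 2 + 2 * sawSigma0 a β) + 2 * a * ‖sawS a β‖) / (a * Real.sqrt (max 0 (sawC2 a β))) *
        ((1 + q + 2 * x ^ 2) * (1 + θ / 2) * W / ((1 - q) * (2 * Real.pi * a) ^ 2)) =
      (R * ((1 + q + 2 * x ^ 2) * ((1 + θ / 2) * W)) * (1 / (1 - q))) / (Real.pi * a) := by
    rw [hR_def]; field_simp; ring
  rw [e, div_le_div_iff₀ (by positivity) ha0]
  have hTW : (1 + θ / 2) * W ≤ 5 * Real.pi := by
    have : (1 + θ / 2) ≤ 5 := by linarith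
    exact mul_le_mul this hW hW0 (by norm_num)
  have hTW0 : 0 ≤ (1 + θ / 2) * W := by positivity
  have h2 : (1 + q + 2 * x ^ 2) * ((1 + θ / 2) * W) ≤ 1.0000126 * (5 * Real.pi) := mul_le_mul hN hTW hTW0 (by norm_num)
  have h20 : 0 ≤ (1 + q + 2 * x ^ 2) * ((1 + θ / 2) * W) := by positivity
  have h3 : (1 + q + 2 * x ^ 2) * ((1 + θ / 2) * W) * (1 / (1 - q)) ≤ 1.0000126 * (5 * Real.pi) * 1.0000001 :=
    mul_le_mul h2 h1q' (by positivity) (by positivity)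
  have h30 : 0 ≤ (1 + q + 2 * x ^ 2) * ((1 + θ / 2) * W) * (1 / (1 - q)) := by positivity
  have h4 : R * ((1 + q + 2 * x ^ 2) * ((1 + θ / 2) * W) * (1 / (1 - q))) ≤ 1.00002 * (1.0000126 * (5 * Real.pi) * 1.0000001) :=
    mul_le_mul hR h3 h30 (by norm_num)
  nlinarith

/-- **The paired mode factor, far modes:** `≤ 25.5/(a(1+(|ξ/a|−8)²))` for `|ξ| ≥ 16a` (quadratic decay in the mode). [folklore] -/
theorem paired_mode_factor_far_le {a : ℝ} (ha : 4 ≤ a) (β ξ : ℝ) {θ : ℝ} (hθ0 : 0 ≤ θ) (hθ : θ ≤ 8) (hfar : 16 * a ≤ |ξ|) :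
    4 * Real.pi * a * (a * (Real.pi / 2 + 2 * sawSigma0 a β) + 2 * a * ‖sawS a β‖) / (a * Real.sqrt (max 0 (sawC2 a β))) *
        ((1 + Real.exp (-(2 * Real.pi * a)) + 2 * Real.exp (-(2 * Real.pi * a) / 4) ^ 2) * (1 + θ / 2) *
          (Real.arctan (ξ / a + θ) - Real.arctan (ξ / a - θ)) / ((1 - Real.exp (-(2 * Real.pi * a))) * (2 * Real.pi * a) ^ 2)) ≤
      25.5 / (a * (1 + (|ξ / a| - 8) ^ 2)) := by
  have ha1 : 1 ≤ a := by linarith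
  have ha0 : 0 < a := by linarith
  have hπ : (3.1415 : ℝ) < Real.pi := Real.pi_gt_d4
  have hR : (a * (Real.pi / 2 + 2 * sawSigma0 a β) + 2 * a * ‖sawS a β‖) / (a * Real.sqrt (max 0 (sawC2 a β))) ≤ 1.00002 :=
    (comb_ratio_le ha1 β).trans (by linarith [comb_ratio_defect_le ha β])
  have hR0 : 0 ≤ (a * (Real.pi / 2 + 2 * sawSigma0 a β) + 2 * a * ‖sawS a β‖) / (a * Real.sqrt (max 0 (sawC2 a β))) := by
    have := kh_p_ge ha1 β; positivity
  have hx := exp_neg_quarter_kappa_le ha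
  have hx0 : 0 ≤ Real.exp (-(2 * Real.pi * a) / 4) := (Real.exp_pos _).le
  have hq : Real.exp (-(2 * Real.pi * a)) ≤ (1 / 400) ^ 4 := exp_neg_kappa_le_pow ha
  have hq0 : 0 < Real.exp (-(2 * Real.pi * a)) := Real.exp_pos _
  have hu : 16 ≤ |ξ / a| := by rw [abs_div, abs_of_pos ha0, le_div_iff₀ ha0]; linarith
  have hW := arctan_window_le_far_abs hθ0 (show θ ≤ |ξ / a| by linarith)
  have hW0 := arctan_window_nonneg hθ0 (ξ / a)
  set x := Real.exp (-(2 * Real.pi * a) / 4) with hxdef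
  set q := Real.exp (-(2 * Real.pi * a)) with hqdef
  set R := (a * (Real.pi / 2 + 2 * sawSigma0 a β) + 2 * a * ‖sawS a β‖) / (a * Real.sqrt (max 0 (sawC2 a β))) with hR_def
  set W := Real.arctan (ξ / a + θ) - Real.arctan (ξ / a - θ) with hW_def
  set v := |ξ / a| with hv
  have hN : 1 + q + 2 * x ^ 2 ≤ 1.0000126 := by
    have h2 : x ^ 2 ≤ (1 / 400) ^ 2 := pow_le_pow_left₀ hx0 hx 2
    norm_num at h2 hq ⊢; linarith
  have h1q : 0 < 1 - q := by norm_num at hq; linarith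
  have h1q' : 1 / (1 - q) ≤ 1.0000001 := by
    rw [div_le_iff₀ h1q]; norm_num at hq ⊢; linarith
  have hL0 : 0 < 1 + (v - 8) ^ 2 := by positivity
  -- `(1+θ/2)·W ≤ (1+θ/2)·2θ/(1+(v−θ)²) ≤ 80/(1+(v−8)²)`
  have hTW : (1 + θ / 2) * W ≤ 80 / (1 + (v - 8) ^ 2) := by
    have h1 : (1 + θ / 2) * W ≤ (1 + θ / 2) * (2 * θ / (1 + (v - θ) ^ 2)) := mul_le_mul_of_nonneg_left hW (by linarith)
    refine h1.trans ?_
    rw [mul_div_assoc', div_le_div_iff₀ (by positivity) hL0]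
    have hA : (1 + θ / 2) * (2 * θ) ≤ 80 := by nlinarith
    have hB : 1 + (v - 8) ^ 2 ≤ 1 + (v - θ) ^ 2 := by nlinarith
    have hA0 : 0 ≤ (1 + θ / 2) * (2 * θ) := by positivity
    calc (1 + θ / 2) * (2 * θ) * (1 + (v - 8) ^ 2) ≤ 80 * (1 + (v - 8) ^ 2) := mul_le_mul_of_nonneg_right hA hL0.le
      _ ≤ 80 * (1 + (v - θ) ^ 2) := mul_le_mul_of_nonneg_left hB (by norm_num)
  have hTW0 : 0 ≤ (1 + θ / 2) * W := by positivity
  have e : 4 * Real.pi * a * (a * (Real.pi / 2 + 2 * sawSigma0 a β) + 2 * a * ‖sawS a β‖) / (a * Real.sqrt (max 0 (sawC2 a β))) *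
        ((1 + q + 2 * x ^ 2) * (1 + θ / 2) * W / ((1 - q) * (2 * Real.pi * a) ^ 2)) =
      (R * ((1 + q + 2 * x ^ 2) * ((1 + θ / 2) * W)) * (1 / (1 - q))) / (Real.pi * a) := by
    rw [hR_def]; field_simp; ring
  rw [e, div_le_div_iff₀ (by positivity) (by positivity)]
  have h2 : (1 + q + 2 * x ^ 2) * ((1 + θ / 2) * W) ≤ 1.0000126 * (80 / (1 + (v - 8) ^ 2)) := mul_le_mul hN hTW hTW0 (by norm_num)
  have h20 : 0 ≤ (1 + q + 2 * x ^ 2) * ((1 + θ / 2) * W) := by positivity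
  have h3 : (1 + q + 2 * x ^ 2) * ((1 + θ / 2) * W) * (1 / (1 - q)) ≤ 1.0000126 * (80 / (1 + (v - 8) ^ 2)) * 1.0000001 :=
    mul_le_mul h2 h1q' (by positivity) (by positivity)
  have h30 : 0 ≤ (1 + q + 2 * x ^ 2) * ((1 + θ / 2) * W) * (1 / (1 - q)) := by positivity
  have h4 : R * ((1 + q + 2 * x ^ 2) * ((1 + θ / 2) * W) * (1 / (1 - q))) ≤ 1.00002 * (1.0000126 * (80 / (1 + (v - 8) ^ 2)) * 1.0000001) :=
    mul_le_mul hR h3 h30 (by norm_num)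
  have h5 : 1.00002 * (1.0000126 * (80 / (1 + (v - 8) ^ 2)) * 1.0000001) * (a * (1 + (v - 8) ^ 2)) =
      1.00002 * 1.0000126 * 80 * 1.0000001 * a := by field_simp
  calc R * ((1 + q + 2 * x ^ 2) * ((1 + θ / 2) * W)) * (1 / (1 - q)) * (a * (1 + (v - 8) ^ 2))
      = R * ((1 + q + 2 * x ^ 2) * ((1 + θ / 2) * W) * (1 / (1 - q))) * (a * (1 + (v - 8) ^ 2)) := by ring
    _ ≤ 1.00002 * (1.0000126 * (80 / (1 + (v - 8) ^ 2)) * 1.0000001) * (a * (1 + (v - 8) ^ 2)) :=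
        mul_le_mul_of_nonneg_right h4 (by positivity)
    _ = 1.00002 * 1.0000126 * 80 * 1.0000001 * a := h5
    _ ≤ 25.5 * (Real.pi * a) := by nlinarith

end Summit.AnomalousDissipation.AnomalousDissipation.Theorems.SawtoothPulseCascade.K2PhaseBudget

end
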